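import Summits.AnomalousDissipation.AnomalousDissipation.Theorems.MomentParityQuarticGateBasis
import Summits.AnomalousDissipation.AnomalousDissipation.Theorems.CubicParityLoud.Negative.EnergyRow

/-!
# Coordinates in an orthonormal band basis (infrastructure I2 for `MomentParity.QuarticGate`,
line `recession-cone`, stmt-AnomalousDissipation-11464)

Given an orthonormal band basis `b : Fin n → (T³ → ℝ³)` of the level-`N` Galerkin space (the
hypothesis bundle `hb`, `hbo`, `hbs` produced by `exists_bandBasis`), the COORDINATES of `u ∈ H` are
`fun i => Torus.pairing u.1 (b i)`. This file records the coordinate calculus: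

* `integral_inner_sum_smul_left`, `integral_norm_sq_sum_smul` — orthonormality in coordinates;
* `coe_ae_eq_sum_of_level` — a level-`N` field IS `Σ_i (u, b i) b i` a.e. (via
  `CubicParityLoud.Negative.fourierTruncate_ae_eq_of_isLevel`, whose `IsLevel` unfolds to the
  level-`N` clause used here);
* `norm_sq_eq_sum_sq_coords` — `‖u‖² = Σ_i (u, b i)²` for level-`N` `u` (Parseval);
* `exists_synthesis`, `exists_level_of_coords` — every `x ∈ ℝⁿ` is the coordinate vector of the
  level-`N` field `Σ_i x_i b_i ∈ H`, with `‖·‖² = Σ x_i²`;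
* `band_eq_sum_smul`, `pairing_band_eq_sum` — a band test `g` is `Σ_i (g, b i) b i`, so the pairing
  `(u, g)` is the linear form `Σ_i (g, b i) (u, b i)` of the coordinates;
* `abs_coord_le_norm`, `continuous_coords`.
-/

namespace Summit.AnomalousDissipation.AnomalousDissipation.Theorems.MomentParityQuarticGate

open MeasureTheory Filter
open scoped InnerProductSpace RealInnerProductSpace ENNReal
open Literature.Analysis.FunctionSpaces Literature.Analysis.FluidPDE
open Summit.AnomalousDissipation.AnomalousDissipation.Theses.MomentParity

set_option linter.dupNamespace false

variable {N n : ℕ} {b : Fin n → UnitAddTorus (Fin 3) → EuclideanSpace ℝ (Fin 3)}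

/-! ## Finite combinations of band tests -/

/-- A finite real combination of band tests is a band test. [folklore] -/
theorem sum_smul_band {ι : Type*} (s : Finset ι) (c : ι → ℝ)
    {e : ι → UnitAddTorus (Fin 3) → EuclideanSpace ℝ (Fin 3)}
    (he : ∀ a, Torus.IsSmooth (e a) ∧ Torus.IsDivFree (e a) ∧ Torus.HasZeroMean (e a) ∧
      ∀ k ∉ (Torus.freqBall N).erase (0 : Fin 3 → ℤ),
        UnitAddTorus.mFourierCoeff (EuclideanSpace.complexify ∘ (e a)) k = 0) :
    Torus.IsSmooth (fun x => ∑ a ∈ s, c a • e a x) ∧ Torus.IsDivFree (fun x => ∑ a ∈ s, c a • e a x) ∧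
      Torus.HasZeroMean (fun x => ∑ a ∈ s, c a • e a x) ∧
      ∀ k ∉ (Torus.freqBall N).erase (0 : Fin 3 → ℤ),
        UnitAddTorus.mFourierCoeff (EuclideanSpace.complexify ∘ fun x => ∑ a ∈ s, c a • e a x) k = 0 := by
  refine ⟨Torus.IsSmooth.sum_smul s c fun a => (he a).1,
    Torus.IsDivFree.sum_smul s c (fun a => (he a).1) fun a => (he a).2.1,
    Torus.HasZeroMean.sum_smul s c (fun a => (he a).1.integrable) fun a => (he a).2.2.1,
    fun k hk => ?_⟩
  rw [mFourierCoeff_complexify_sum_smul s c (fun a => (he a).1.continuous) k]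
  exact Finset.sum_eq_zero fun a _ => by rw [(he a).2.2.2 k hk, smul_zero]

/-! ## Orthonormality in coordinates -/

/-- `∫ ⟪Σ_j c_j b_j, b_i⟫ = c_i` for an `L²`-orthonormal family of smooth fields. [folklore] -/
theorem integral_inner_sum_smul_left
    (hb : ∀ i, Torus.IsSmooth (b i) ∧ Torus.IsDivFree (b i) ∧ Torus.HasZeroMean (b i) ∧
      ∀ k ∉ (Torus.freqBall N).erase (0 : Fin 3 → ℤ),
        UnitAddTorus.mFourierCoeff (EuclideanSpace.complexify ∘ (b i)) k = 0)
    (hbo : ∀ i j, ∫ x, ⟪b i x, b j x⟫_ℝ = if i = j then (1 : ℝ) else 0)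
    (c : Fin n → ℝ) (i : Fin n) :
    ∫ y, ⟪∑ j, c j • b j y, b i y⟫_ℝ = c i := by
  have hint : ∀ j, Integrable (fun y => ⟪b j y, b i y⟫_ℝ) volume := fun j =>
    Torus.integrable_inner_of_continuous (hb j).1.integrable (hb i).1.continuous
  simp_rw [sum_inner, real_inner_smul_left]
  rw [integral_finsetSum _ fun j _ => (hint j).const_mul (c j)]
  simp_rw [integral_const_mul, hbo, mul_ite, mul_one, mul_zero]
  rw [Finset.sum_ite_eq' Finset.univ i]
  simp

/-- `∫ ⟪Σ_i c_i b_i, Σ_j c'_j b_j⟫ = Σ_i c_i c'_i`. [folklore] -/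
theorem integral_inner_sum_smul
    (hb : ∀ i, Torus.IsSmooth (b i) ∧ Torus.IsDivFree (b i) ∧ Torus.HasZeroMean (b i) ∧
      ∀ k ∉ (Torus.freqBall N).erase (0 : Fin 3 → ℤ),
        UnitAddTorus.mFourierCoeff (EuclideanSpace.complexify ∘ (b i)) k = 0)
    (hbo : ∀ i j, ∫ x, ⟪b i x, b j x⟫_ℝ = if i = j then (1 : ℝ) else 0)
    (c c' : Fin n → ℝ) :
    ∫ y, ⟪∑ i, c i • b i y, ∑ j, c' j • b j y⟫_ℝ = ∑ i, c i * c' i := by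
  have hsm : Torus.IsSmooth (fun y => ∑ i, c i • b i y) := Torus.IsSmooth.sum_smul _ c fun i => (hb i).1
  have hint : ∀ j, Integrable (fun y => ⟪∑ i, c i • b i y, b j y⟫_ℝ) volume := fun j =>
    Torus.integrable_inner_of_continuous hsm.integrable (hb j).1.continuous
  simp_rw [inner_sum, real_inner_smul_right]
  rw [integral_finsetSum _ fun j _ => (hint j).const_mul (c' j)]
  simp_rw [integral_const_mul, integral_inner_sum_smul_left hb hbo]
  exact Finset.sum_congr rfl fun i _ => mul_comm _ _

/-- `∫ ‖Σ_i c_i b_i‖² = Σ_i c_i²` (finite Parseval in the orthonormal family). [folklore] -/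
theorem integral_norm_sq_sum_smul
    (hb : ∀ i, Torus.IsSmooth (b i) ∧ Torus.IsDivFree (b i) ∧ Torus.HasZeroMean (b i) ∧
      ∀ k ∉ (Torus.freqBall N).erase (0 : Fin 3 → ℤ),
        UnitAddTorus.mFourierCoeff (EuclideanSpace.complexify ∘ (b i)) k = 0)
    (hbo : ∀ i j, ∫ x, ⟪b i x, b j x⟫_ℝ = if i = j then (1 : ℝ) else 0)
    (c : Fin n → ℝ) :
    ∫ y, ‖∑ i, c i • b i y‖ ^ 2 = ∑ i, c i ^ 2 := by
  simp_rw [← real_inner_self_eq_norm_sq, integral_inner_sum_smul hb hbo, sq]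

/-! ## Level-`N` fields in coordinates -/

/-- **A level-`N` field is `Σ_i (u, b i) b i` almost everywhere.** [folklore] -/
theorem coe_ae_eq_sum_of_level
    (hbs : ∀ u : Torus.energySpace (Fin 3),
      (∀ k ∉ (Torus.freqBall N).erase (0 : Fin 3 → ℤ),
        UnitAddTorus.mFourierCoeff (EuclideanSpace.complexify ∘
          (u.1 : UnitAddTorus (Fin 3) → EuclideanSpace ℝ (Fin 3))) k = 0) →
      ∀ x, Torus.fourierTruncate N (u.1 : UnitAddTorus (Fin 3) → EuclideanSpace ℝ (Fin 3)) x =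
        ∑ i, Torus.pairing u.1 (b i) • b i x)
    (u : Torus.energySpace (Fin 3))
    (hu : ∀ k ∉ (Torus.freqBall N).erase (0 : Fin 3 → ℤ),
      UnitAddTorus.mFourierCoeff (EuclideanSpace.complexify ∘
        (u.1 : UnitAddTorus (Fin 3) → EuclideanSpace ℝ (Fin 3))) k = 0) :
    (u.1 : UnitAddTorus (Fin 3) → EuclideanSpace ℝ (Fin 3)) =ᵐ[volume]
      fun y => ∑ i, Torus.pairing u.1 (b i) • b i y :=
  (CubicParityLoud.Negative.fourierTruncate_ae_eq_of_isLevel hu).symm.trans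
    (Eventually.of_forall (hbs u hu))

/-- **Parseval in the band basis**: `‖u‖² = Σ_i (u, b i)²` for a level-`N` field `u ∈ H`.
[folklore] -/
theorem norm_sq_eq_sum_sq_coords
    (hb : ∀ i, Torus.IsSmooth (b i) ∧ Torus.IsDivFree (b i) ∧ Torus.HasZeroMean (b i) ∧
      ∀ k ∉ (Torus.freqBall N).erase (0 : Fin 3 → ℤ),
        UnitAddTorus.mFourierCoeff (EuclideanSpace.complexify ∘ (b i)) k = 0)
    (hbo : ∀ i j, ∫ x, ⟪b i x, b j x⟫_ℝ = if i = j then (1 : ℝ) else 0)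
    (hbs : ∀ u : Torus.energySpace (Fin 3),
      (∀ k ∉ (Torus.freqBall N).erase (0 : Fin 3 → ℤ),
        UnitAddTorus.mFourierCoeff (EuclideanSpace.complexify ∘
          (u.1 : UnitAddTorus (Fin 3) → EuclideanSpace ℝ (Fin 3))) k = 0) →
      ∀ x, Torus.fourierTruncate N (u.1 : UnitAddTorus (Fin 3) → EuclideanSpace ℝ (Fin 3)) x =
        ∑ i, Torus.pairing u.1 (b i) • b i x)
    (u : Torus.energySpace (Fin 3))
    (hu : ∀ k ∉ (Torus.freqBall N).erase (0 : Fin 3 → ℤ),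
      UnitAddTorus.mFourierCoeff (EuclideanSpace.complexify ∘
        (u.1 : UnitAddTorus (Fin 3) → EuclideanSpace ℝ (Fin 3))) k = 0) :
    ‖u‖ ^ 2 = ∑ i, (Torus.pairing u.1 (b i)) ^ 2 := by
  rw [show ‖u‖ = ‖u.1‖ from rfl, ← Torus.integral_norm_sq_coe_eq, ← integral_norm_sq_sum_smul hb hbo]
  refine integral_congr_ae ?_
  filter_upwards [coe_ae_eq_sum_of_level hbs u hu] with y hy
  rw [hy]

/-- The coordinates are bounded by the norm: `|(u, b i)| ≤ ‖u‖` (`‖b i‖_{L²} = 1`). [folklore] -/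
theorem abs_coord_le_norm
    (hb : ∀ i, Torus.IsSmooth (b i) ∧ Torus.IsDivFree (b i) ∧ Torus.HasZeroMean (b i) ∧
      ∀ k ∉ (Torus.freqBall N).erase (0 : Fin 3 → ℤ),
        UnitAddTorus.mFourierCoeff (EuclideanSpace.complexify ∘ (b i)) k = 0)
    (hbo : ∀ i j, ∫ x, ⟪b i x, b j x⟫_ℝ = if i = j then (1 : ℝ) else 0)
    (u : Torus.energySpace (Fin 3)) (i : Fin n) :
    |Torus.pairing u.1 (b i)| ≤ ‖u‖ := by
  have h2 : MemLp (b i) 2 volume := (hb i).1.memLp 2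
  have hn : ‖h2.toLp (b i)‖ = 1 := by
    rw [Torus.norm_toLp_eq_sqrt h2]
    have h1 : ∫ y, ‖b i y‖ ^ 2 = 1 := by
      simp_rw [← real_inner_self_eq_norm_sq, hbo i i, if_true]
    rw [h1, Real.sqrt_one]
  simpa [hn] using Torus.abs_pairing_coe_le h2 u

/-- The coordinate map `u ↦ ((u, b i))_i` is continuous on `H`. [folklore] -/
theorem continuous_coords
    (hb : ∀ i, Torus.IsSmooth (b i) ∧ Torus.IsDivFree (b i) ∧ Torus.HasZeroMean (b i) ∧
      ∀ k ∉ (Torus.freqBall N).erase (0 : Fin 3 → ℤ),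
        UnitAddTorus.mFourierCoeff (EuclideanSpace.complexify ∘ (b i)) k = 0) :
    Continuous fun u : Torus.energySpace (Fin 3) => fun i => Torus.pairing u.1 (b i) :=
  continuous_pi fun i => Torus.continuous_pairing_coe ((hb i).1.memLp 2)

/-! ## Synthesis: every coordinate vector is realised by a level-`N` field -/

/-- A smooth solenoidal mean-zero field has a class in `H` representing it a.e. [folklore] -/
theorem exists_energySpace_coe_ae_eq {g : UnitAddTorus (Fin 3) → EuclideanSpace ℝ (Fin 3)}
    (hs : Torus.IsSmooth g) (hd : Torus.IsDivFree g) (hz : Torus.HasZeroMean g) :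
    ∃ U : Torus.energySpace (Fin 3),
      (U.1 : UnitAddTorus (Fin 3) → EuclideanSpace ℝ (Fin 3)) =ᵐ[volume] g :=
  ⟨⟨(hs.memLp 2).toLp g, Torus.smoothSolenoidal_subset_energySpace
    ⟨g, hs, hd, hz, (hs.memLp 2).coeFn_toLp⟩⟩, (hs.memLp 2).coeFn_toLp⟩

/-- A class represented a.e. by a band-limited field is level-`N`. [folklore] -/
theorem level_of_coe_ae_eq {U : Torus.energySpace (Fin 3)}
    {g : UnitAddTorus (Fin 3) → EuclideanSpace ℝ (Fin 3)}
    (hUg : (U.1 : UnitAddTorus (Fin 3) → EuclideanSpace ℝ (Fin 3)) =ᵐ[volume] g)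
    (hg : ∀ k ∉ (Torus.freqBall N).erase (0 : Fin 3 → ℤ),
      UnitAddTorus.mFourierCoeff (EuclideanSpace.complexify ∘ g) k = 0) :
    ∀ k ∉ (Torus.freqBall N).erase (0 : Fin 3 → ℤ),
      UnitAddTorus.mFourierCoeff (EuclideanSpace.complexify ∘
        (U.1 : UnitAddTorus (Fin 3) → EuclideanSpace ℝ (Fin 3))) k = 0 :=
  fun k hk => by rw [Torus.mFourierCoeff_congr_ae (hUg.fun_comp EuclideanSpace.complexify) k, hg k hk]

/-- **Synthesis map.** There are classes `B i ∈ H` of the basis fields such that for every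
`x ∈ ℝⁿ` the field `Σ_i x_i B_i ∈ H` is level-`N`, has coordinates `x`, norm `‖·‖² = Σ x_i²`, and
is represented a.e. by `Σ_i x_i b_i`. [folklore] -/
theorem exists_synthesis
    (hb : ∀ i, Torus.IsSmooth (b i) ∧ Torus.IsDivFree (b i) ∧ Torus.HasZeroMean (b i) ∧
      ∀ k ∉ (Torus.freqBall N).erase (0 : Fin 3 → ℤ),
        UnitAddTorus.mFourierCoeff (EuclideanSpace.complexify ∘ (b i)) k = 0)
    (hbo : ∀ i j, ∫ x, ⟪b i x, b j x⟫_ℝ = if i = j then (1 : ℝ) else 0) :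
    ∃ B : Fin n → Torus.energySpace (Fin 3), ∀ x : Fin n → ℝ,
      (∀ k ∉ (Torus.freqBall N).erase (0 : Fin 3 → ℤ),
        UnitAddTorus.mFourierCoeff (EuclideanSpace.complexify ∘
          ((∑ i, x i • B i : Torus.energySpace (Fin 3)).1 :
            UnitAddTorus (Fin 3) → EuclideanSpace ℝ (Fin 3))) k = 0) ∧
      (fun i => Torus.pairing (∑ i, x i • B i : Torus.energySpace (Fin 3)).1 (b i)) = x ∧
      ‖(∑ i, x i • B i : Torus.energySpace (Fin 3))‖ ^ 2 = ∑ i, x i ^ 2 ∧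
      ((∑ i, x i • B i : Torus.energySpace (Fin 3)).1 :
          UnitAddTorus (Fin 3) → EuclideanSpace ℝ (Fin 3)) =ᵐ[volume]
        fun y => ∑ i, x i • b i y := by
  have hB : ∀ i, ∃ U : Torus.energySpace (Fin 3),
      (U.1 : UnitAddTorus (Fin 3) → EuclideanSpace ℝ (Fin 3)) =ᵐ[volume] b i := fun i =>
    exists_energySpace_coe_ae_eq (hb i).1 (hb i).2.1 (hb i).2.2.1
  choose B hB using hB
  have hBall : ∀ᵐ y ∂volume, ∀ i, ((B i).1 : UnitAddTorus (Fin 3) → EuclideanSpace ℝ (Fin 3)) y =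
      b i y := eventually_all.2 hB
  refine ⟨B, fun x => ?_⟩
  have hae : ((∑ i, x i • B i : Torus.energySpace (Fin 3)).1 :
      UnitAddTorus (Fin 3) → EuclideanSpace ℝ (Fin 3)) =ᵐ[volume] fun y => ∑ i, x i • b i y := by
    rw [Submodule.coe_sum]
    simp_rw [Submodule.coe_smul]
    filter_upwards [coeFn_sum_smul Finset.univ x fun i => (B i).1, hBall] with y hy hy'
    rw [hy]
    exact Finset.sum_congr rfl fun i _ => by rw [hy' i]
  have hband := sum_smul_band Finset.univ x hb
  refine ⟨level_of_coe_ae_eq hae hband.2.2.2, ?_, ?_, hae⟩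
  · funext i
    calc Torus.pairing (∑ i, x i • B i : Torus.energySpace (Fin 3)).1 (b i)
        = ∫ y, ⟪∑ j, x j • b j y, b i y⟫_ℝ := by
          refine integral_congr_ae ?_
          filter_upwards [hae] with y hy
          rw [hy]
      _ = x i := integral_inner_sum_smul_left hb hbo x i
  · rw [show ‖(∑ i, x i • B i : Torus.energySpace (Fin 3))‖ =
        ‖(∑ i, x i • B i : Torus.energySpace (Fin 3)).1‖ from rfl,
      ← Torus.integral_norm_sq_coe_eq, ← integral_norm_sq_sum_smul hb hbo x]
    refine integral_congr_ae ?_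
    filter_upwards [hae] with y hy
    rw [hy]

/-- **I2a — every coordinate vector is realised**: for `x ∈ ℝⁿ` there is a level-`N` `u ∈ H` with
coordinates `x`, `‖u‖² = Σ x_i²`, represented a.e. by `Σ_i x_i b_i`. [folklore] -/
theorem exists_level_of_coords :
    ∀ {N n : ℕ} {b : Fin n → UnitAddTorus (Fin 3) → EuclideanSpace ℝ (Fin 3)},
      (∀ i, Torus.IsSmooth (b i) ∧ Torus.IsDivFree (b i) ∧ Torus.HasZeroMean (b i) ∧
        ∀ k ∉ (Torus.freqBall N).erase (0 : Fin 3 → ℤ),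
          UnitAddTorus.mFourierCoeff (EuclideanSpace.complexify ∘ (b i)) k = 0) →
      (∀ i j, ∫ x, ⟪b i x, b j x⟫_ℝ = if i = j then (1 : ℝ) else 0) →
      ∀ x : Fin n → ℝ, ∃ u : Torus.energySpace (Fin 3),
        (∀ k ∉ (Torus.freqBall N).erase (0 : Fin 3 → ℤ),
          UnitAddTorus.mFourierCoeff (EuclideanSpace.complexify ∘
            (u.1 : UnitAddTorus (Fin 3) → EuclideanSpace ℝ (Fin 3))) k = 0) ∧
        (fun i => Torus.pairing u.1 (b i)) = x ∧ ‖u‖ ^ 2 = ∑ i, x i ^ 2 ∧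
        (u.1 : UnitAddTorus (Fin 3) → EuclideanSpace ℝ (Fin 3)) =ᵐ[volume]
          fun y => ∑ i, x i • b i y := by
  intro N n b hb hbo x
  obtain ⟨B, hB⟩ := exists_synthesis hb hbo
  exact ⟨_, hB x⟩

/-! ## Band tests in coordinates -/

/-- **I2b — a band test is the finite combination `g = Σ_i (g, b i) b i`** (pointwise). [folklore] -/
theorem band_eq_sum_smul
    (hbs : ∀ u : Torus.energySpace (Fin 3),
      (∀ k ∉ (Torus.freqBall N).erase (0 : Fin 3 → ℤ),
        UnitAddTorus.mFourierCoeff (EuclideanSpace.complexify ∘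
          (u.1 : UnitAddTorus (Fin 3) → EuclideanSpace ℝ (Fin 3))) k = 0) →
      ∀ x, Torus.fourierTruncate N (u.1 : UnitAddTorus (Fin 3) → EuclideanSpace ℝ (Fin 3)) x =
        ∑ i, Torus.pairing u.1 (b i) • b i x)
    {g : UnitAddTorus (Fin 3) → EuclideanSpace ℝ (Fin 3)}
    (hg : Torus.IsSmooth g ∧ Torus.IsDivFree g ∧ Torus.HasZeroMean g ∧
      ∀ k ∉ (Torus.freqBall N).erase (0 : Fin 3 → ℤ),
        UnitAddTorus.mFourierCoeff (EuclideanSpace.complexify ∘ g) k = 0)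
    (x : UnitAddTorus (Fin 3)) :
    g x = ∑ i, (∫ y, ⟪g y, b i y⟫_ℝ) • b i x := by
  obtain ⟨U, hUg⟩ := exists_energySpace_coe_ae_eq hg.1 hg.2.1 hg.2.2.1
  have hU := level_of_coe_ae_eq hUg hg.2.2.2
  -- `P_N U = P_N g = g`
  have h1 : Torus.fourierTruncate N (U.1 : UnitAddTorus (Fin 3) → EuclideanSpace ℝ (Fin 3)) =
      Torus.fourierTruncate N g := by
    rw [Torus.fourierTruncate_eq, Torus.fourierTruncate_eq]
    congr 1
    funext k
    exact Torus.mFourierCoeff_congr_ae (hUg.fun_comp EuclideanSpace.complexify) k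
  have h2 : Torus.fourierTruncate N g = g := by
    refine eq_of_ae_eq_of_continuous (Torus.continuous_fourierTruncate N g) hg.1.continuous ?_
    rw [← h1]
    exact (CubicParityLoud.Negative.fourierTruncate_ae_eq_of_isLevel hU).trans hUg
  have h3 : ∀ i, Torus.pairing U.1 (b i) = ∫ y, ⟪g y, b i y⟫_ℝ := fun i =>
    integral_congr_ae (by
      filter_upwards [hUg] with y hy
      rw [hy])
  calc g x = Torus.fourierTruncate N (U.1 : UnitAddTorus (Fin 3) → EuclideanSpace ℝ (Fin 3)) x := by
        rw [h1, h2]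
    _ = ∑ i, Torus.pairing U.1 (b i) • b i x := hbs U hU x
    _ = ∑ i, (∫ y, ⟪g y, b i y⟫_ℝ) • b i x := by simp_rw [h3]

/-- **I2c — the pairing with a band test is a linear form in the coordinates**:
`(u, g) = Σ_i (g, b i) (u, b i)` for every `u ∈ H`. [folklore] -/
theorem pairing_band_eq_sum
    (hb : ∀ i, Torus.IsSmooth (b i) ∧ Torus.IsDivFree (b i) ∧ Torus.HasZeroMean (b i) ∧
      ∀ k ∉ (Torus.freqBall N).erase (0 : Fin 3 → ℤ),
        UnitAddTorus.mFourierCoeff (EuclideanSpace.complexify ∘ (b i)) k = 0)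
    (hbs : ∀ u : Torus.energySpace (Fin 3),
      (∀ k ∉ (Torus.freqBall N).erase (0 : Fin 3 → ℤ),
        UnitAddTorus.mFourierCoeff (EuclideanSpace.complexify ∘
          (u.1 : UnitAddTorus (Fin 3) → EuclideanSpace ℝ (Fin 3))) k = 0) →
      ∀ x, Torus.fourierTruncate N (u.1 : UnitAddTorus (Fin 3) → EuclideanSpace ℝ (Fin 3)) x =
        ∑ i, Torus.pairing u.1 (b i) • b i x)
    {g : UnitAddTorus (Fin 3) → EuclideanSpace ℝ (Fin 3)}
    (hg : Torus.IsSmooth g ∧ Torus.IsDivFree g ∧ Torus.HasZeroMean g ∧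
      ∀ k ∉ (Torus.freqBall N).erase (0 : Fin 3 → ℤ),
        UnitAddTorus.mFourierCoeff (EuclideanSpace.complexify ∘ g) k = 0)
    (u : Torus.energySpace (Fin 3)) :
    Torus.pairing u.1 g = ∑ i, (∫ y, ⟪g y, b i y⟫_ℝ) * Torus.pairing u.1 (b i) := by
  have hint : ∀ i, Integrable (fun y =>
      ⟪(u.1 : UnitAddTorus (Fin 3) → EuclideanSpace ℝ (Fin 3)) y, b i y⟫_ℝ) volume := fun i =>
    Torus.integrable_inner_of_continuous ((Lp.memLp u.1).integrable one_le_two) (hb i).1.continuous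
  calc Torus.pairing u.1 g
      = ∫ y, ⟪(u.1 : UnitAddTorus (Fin 3) → EuclideanSpace ℝ (Fin 3)) y,
          ∑ i, (∫ z, ⟪g z, b i z⟫_ℝ) • b i y⟫_ℝ :=
        integral_congr_ae (ae_of_all _ fun y => congrArg _ (band_eq_sum_smul hbs hg y))
    _ = ∑ i, (∫ y, ⟪g y, b i y⟫_ℝ) * Torus.pairing u.1 (b i) := by
        simp_rw [inner_sum, real_inner_smul_right]
        rw [integral_finsetSum _ fun i _ => (hint i).const_mul _]
        simp_rw [integral_const_mul]
        rfl

end Summit.AnomalousDissipation.AnomalousDissipation.Theorems.MomentParityQuarticGate
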